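import Literature.Probability.Percolation.TrackExchangeReflect
import HarnessLib

/-!
# One block of track exchanges in either direction

Grimmett–Manolescu, *Bond percolation on isoradial graphs* (PTRF 159 (2014) 273–327 =
arXiv:1204.0505), §5.3 ("If `β_j < β_{j-1}`, we construct `Σ_j` 'from right to left'") and
§6.2 (proof of Lemma 6.6: "Without loss of generality we may suppose `β_k > ξ`, so that
`d_{k+1} = d_k + 1` and the track-exchanges in the application of `U := U_{k+1}` are all from
left to right"; proof of Lemma 6.5: "The argument is valid regardless of the direction of
`Σ_j`").

The block `BlockData.blockW` of `TrackExchangeBlock` sweeps from left to right (`βk > ξ`). This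
file provides the block of the other direction as its conjugate by the reflection of the strip
(`TrackExchangeReflect`), and transfers the pathwise theorem `blockW_spec`:

* `BlockData.refl B` — the reflected data (`α' i = -α (-1-i)`, `base' = π - base`,
  `βk' = π - βk`, `ξ' = π - ξ`); `refl_valid`: it is valid when `βk < ξ` and the angles are
  bounded; `refl_D_initial`: its weights are the original ones read through the reflection.
* `BlockData.blockWRL B r n x = reflW (B.refl.blockW r n (reflW x))` — **the right-to-left
  block**; `blockWRL_fst` (walk-independence of the configuration component).
* **`BlockData.blockWRL_spec`** — the block invariant of the reflected block on the reflected
  data, for the original start: clean/open/endpoints/`⋆`-avoidance/primality/nonnegativity in the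
  original coordinates (`BlockInvRL`), the envelope and the provenance in the reflected ones
  (as `B.refl.BlockInv` of the reflected walk), ready for the growth dichotomy via
  `colmax_map_reflL`.

## References

* G. R. Grimmett, I. Manolescu, PTRF 159 (2014) 273–327, arXiv:1204.0505, §5.3, §6.2 (Lemmas
  6.5, 6.6 and the remarks on directions).
-/

noncomputable section

namespace Literature.Probability.Percolation

open LatticeModels StarTriangle Real MeasureTheory

namespace TrackExchange

namespace BlockData

variable (B : BlockData)

/-- **The reflected block data**: column angles `i ↦ -α(-1-i)`, all row angles replaced by their
supplements; the direction of every exchange is reversed. [cite: GrimmettManolescu2014Isoradial, §5.3] -/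
def refl : BlockData :=
  { M := B.M, α := fun i => -B.α (-1 - i), base := fun y => π - B.base y, βk := π - B.βk, ξ := π - B.ξ,
    b := B.b, N := B.N }

/-- Unfolding. [folklore] -/
@[simp] theorem refl_M : B.refl.M = B.M := rfl
/-- Unfolding. [folklore] -/
@[simp] theorem refl_N : B.refl.N = B.N := rfl
/-- Unfolding. [folklore] -/
@[simp] theorem refl_b : B.refl.b = B.b := rfl
/-- Unfolding. [folklore] -/
@[simp] theorem refl_level (s : ℕ) : B.refl.level s = B.level s := rfl

/-- The row angles of the reflected block are the supplements. [folklore] -/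
theorem refl_rowβ (s : ℕ) (y : ℤ) : B.refl.rowβ s y = π - B.rowβ s y := by
  simp only [rowβ, refl_level]
  split_ifs <;> rfl

/-- **The weights of the reflected block are the original ones read through the reflection.**
[cite: GrimmettManolescu2014Isoradial, §4.6] -/
theorem refl_D_initial (s : ℕ) : (B.refl.D s).initial = canonicalWeight B.M (Θrefl fun i y => B.rowβ s y - B.α i) := by
  show canonicalWeight B.M (fun i y => B.refl.rowβ s y - (-B.α (-1 - i))) = _
  congr 1
  funext i y
  rw [refl_rowβ, Θrefl]; ring

/-- The weights of the block, as canonical weights. [folklore] -/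
theorem D_initial (s : ℕ) : (B.D s).initial = canonicalWeight B.M (fun i y => B.rowβ s y - B.α i) := rfl

/-- **Two-sided hypotheses of a block**: bounded angles on the strip for the regular and the
descending tracks, the regular block, `b ≥ 1`, and `βk < ξ` (the right-to-left case; then the
angle condition `ξ - βk < π` is automatic from the bounded angles at any column). [cite: GrimmettManolescu2014Isoradial, §6.2] -/
structure ValidRL : Prop where
  /-- direction: right to left -/
  dir : B.βk < B.ξ
  /-- the strip is nonempty -/
  M_pos : 0 < B.M
  /-- bounded angles, regular tracks -/
  lo : ∀ i : ℤ, -(B.M : ℤ) ≤ i → i < B.M → B.ξ - B.α i ∈ Set.Ioo 0 π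
  /-- bounded angles, descending track -/
  up : ∀ i : ℤ, -(B.M : ℤ) ≤ i → i < B.M → B.βk - B.α i ∈ Set.Ioo 0 π
  /-- the block of regular tracks -/
  base_eq : ∀ y, B.b - 1 ≤ y → y ≤ B.b + B.N - 1 → B.base y = B.ξ
  /-- the lowest level is at least `1` -/
  one_le_b : 1 ≤ B.b

variable {B}

/-- **The reflected data of a right-to-left block are a valid (left-to-right) block.**
[cite: GrimmettManolescu2014Isoradial, §5.3] -/
theorem refl_valid (h : B.ValidRL) : B.refl.Valid := by
  have hM : (0 : ℤ) < B.M := by exact_mod_cast h.M_pos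
  have h0l := h.lo (-1) (by omega) (by omega)
  have h0u := h.up (-1) (by omega) (by omega)
  refine ⟨⟨?_, ?_⟩, fun i hi hi' => ?_, fun i hi hi' => ?_, fun y hy hy' => ?_, ?_⟩
  · show 0 < (π - B.βk) - (π - B.ξ); linarith [h.dir]
  · show (π - B.βk) - (π - B.ξ) < π; linarith [h0l.2, h0u.1]
  · have h1 := h.lo (-1 - i) (by simp [refl] at hi hi'; omega) (by simp [refl] at hi hi'; omega)
    show (π - B.ξ) - (-B.α (-1 - i)) ∈ Set.Ioo 0 π
    exact ⟨by linarith [h1.2], by linarith [h1.1]⟩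
  · have h1 := h.up (-1 - i) (by simp [refl] at hi hi'; omega) (by simp [refl] at hi hi'; omega)
    show (π - B.βk) - (-B.α (-1 - i)) ∈ Set.Ioo 0 π
    exact ⟨by linarith [h1.2], by linarith [h1.1]⟩
  · show π - B.base y = π - B.ξ
    rw [h.base_eq y hy hy']
  · show 1 ≤ B.b; exact h.one_le_b

/-! ### The right-to-left block -/

variable (B)

/-- **The right-to-left block**: reflect, run the left-to-right block of the reflected data,
reflect back. [cite: GrimmettManolescu2014Isoradial, §5.3] -/
def blockWRL (r : ℕ → B.Noise) (n : ℕ) (x : ExchangeData.WState) : ExchangeData.WState :=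
  reflW (B.refl.blockW r n (reflW x))

/-- The configuration component of the right-to-left block does not depend on the walk. [folklore] -/
theorem blockWRL_fst (r : ℕ → B.Noise) (n : ℕ) (x : ExchangeData.WState) :
    (B.blockWRL r n x).1 = (B.blockWRL r n (x.1, [])).1 := by
  unfold blockWRL reflW
  simp only
  rw [B.refl.blockW_fst r n (reflCfg x.1, List.map reflL x.2), B.refl.blockW_fst r n (reflCfg x.1, List.map reflL [])]

variable {B}

/-- **The right-to-left block, pathwise** (GM14 Lemma 6.5 and the first part of the proof of
Lemma 6.6, for a block sweeping from right to left): the block invariant of the reflected data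
holds for the reflected walk, started from the reflection of an admissible start. The conclusions
about the configuration and the walk transfer back by `reflW_reflW`, `clean_reflCfg`,
`mem_map_reflL_iff`, `colmax_map_reflL`. [cite: GrimmettManolescu2014Isoradial, §6.2] -/
theorem blockWRL_spec (hB : B.ValidRL) {W₀ : List SV} {P₀ P₁ : SV} (r : ℕ → B.Noise)
    (hP₀ : ∃ x₀ : ℤ, P₀ = some (x₀, 0)) (hP₁ : ∃ x₁ : ℤ, P₁ = some (x₁, 0))
    (hpar₀ : ∀ m h, some (m, h) ∈ W₀ → Even (m + h)) {C : ℤ}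
    (htent : ∀ m h, some (m, h) ∈ W₀ → |m| + h ≤ C ∧ 0 ≤ h) (hM : C + 3 ≤ B.M) (hb : 0 ≤ B.b)
    {ω : Set (Sym2 SV)} (hC : Clean (B.D 0).initial ω) (hW : IsWalk ω W₀) (hh : W₀.head? = some P₀)
    (hl : W₀.getLast? = some P₁) (hn : none ∉ W₀) :
    ∀ n ≤ B.N, B.refl.BlockInv (W₀.map reflL) (reflL P₀) (reflL P₁) r n (B.refl.blockW r n (reflW (ω, W₀))) := by
  obtain ⟨x₀, rfl⟩ := hP₀
  obtain ⟨x₁, rfl⟩ := hP₁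
  refine BlockData.blockW_spec (refl_valid hB) r ⟨-x₀, rfl⟩ ⟨-x₁, rfl⟩ (fun m h hm => ?_) (C := C)
    (fun m h hm => ?_) (by simpa using hM) (by simpa using hb) ?_ (isWalk_reflW (x := (ω, W₀)) hW) ?_ ?_ ?_
  · rw [mem_map_reflL_iff] at hm
    obtain ⟨c, hc⟩ := hpar₀ _ _ hm; exact ⟨c + m, by omega⟩
  · rw [mem_map_reflL_iff] at hm
    have := htent _ _ hm; rw [abs_neg] at this; exact this
  · show Clean (B.refl.D 0).initial (reflCfg ω)
    rw [refl_D_initial]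
    exact clean_reflCfg (by rw [← D_initial]; exact hC)
  · show (W₀.map reflL).head? = some (reflL (some (x₀, 0)))
    rw [List.head?_map, hh]; rfl
  · show (W₀.map reflL).getLast? = some (reflL (some (x₁, 0)))
    rw [List.getLast?_map, hl]; rfl
  · show none ∉ W₀.map reflL
    rw [none_mem_map_reflL_iff]; exact hn

/-- **Back in the original coordinates**: after the right-to-left block the configuration is
clean for the block's final weights and the walk is open with the same endpoints, avoids `⋆`, is
primal with nonnegative heights, and lies in the widened tent. [cite: GrimmettManolescu2014Isoradial, §6.2 Lemma 6.5] -/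
theorem blockWRL_conclusions (hB : B.ValidRL) {W₀ : List SV} {P₀ P₁ : SV} (r : ℕ → B.Noise)
    (hP₀ : ∃ x₀ : ℤ, P₀ = some (x₀, 0)) (hP₁ : ∃ x₁ : ℤ, P₁ = some (x₁, 0))
    (hpar₀ : ∀ m h, some (m, h) ∈ W₀ → Even (m + h)) {C : ℤ}
    (htent : ∀ m h, some (m, h) ∈ W₀ → |m| + h ≤ C ∧ 0 ≤ h) (hM : C + 3 ≤ B.M) (hb : 0 ≤ B.b)
    {ω : Set (Sym2 SV)} (hC : Clean (B.D 0).initial ω) (hW : IsWalk ω W₀) (hh : W₀.head? = some P₀)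
    (hl : W₀.getLast? = some P₁) (hn : none ∉ W₀) :
    let x' := B.blockWRL r B.N (ω, W₀)
    Clean (B.D B.N).initial x'.1 ∧ IsWalk x'.1 x'.2 ∧ x'.2.head? = some P₀ ∧ x'.2.getLast? = some P₁ ∧
      none ∉ x'.2 ∧ (∀ m y, some (m, y) ∈ x'.2 → Even (m + y)) ∧ (∀ m y, some (m, y) ∈ x'.2 → 0 ≤ y) ∧
      ∀ m y, some (m, y) ∈ x'.2 → |m| + y ≤ C + 2 := by
  intro x'
  have hinv := blockWRL_spec hB r hP₀ hP₁ hpar₀ htent hM hb hC hW hh hl hn B.N le_rfl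
  set y := B.refl.blockW r B.N (reflW (ω, W₀)) with hy
  have hx' : x' = reflW y := rfl
  have hlev : B.refl.level B.N = B.b - 1 := by rw [refl_level]; simp only [level]; ring
  refine ⟨?_, ?_, ?_, ?_, ?_, ?_, ?_, ?_⟩
  · rw [hx']
    show Clean (B.D B.N).initial (reflCfg y.1)
    have h1 : Clean (B.refl.D B.N).initial y.1 := hinv.clean
    rw [refl_D_initial] at h1
    have h2 := clean_reflCfg h1
    rw [Θrefl_Θrefl] at h2
    exact h2
  · rw [hx']; exact isWalk_reflW hinv.walk
  · rw [hx']
    show (y.2.map reflL).head? = some P₀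
    rw [List.head?_map, hinv.head]; simp
  · rw [hx']
    show (y.2.map reflL).getLast? = some P₁
    rw [List.getLast?_map, hinv.last]; simp
  · rw [hx']
    show none ∉ y.2.map reflL
    rw [none_mem_map_reflL_iff]; exact hinv.none_not_mem
  · intro m v hm
    rw [hx'] at hm
    change some (m, v) ∈ y.2.map reflL at hm
    rw [mem_map_reflL_iff] at hm
    obtain ⟨c, hc⟩ := hinv.parity _ _ hm; exact ⟨c + m, by omega⟩
  · intro m v hm
    rw [hx'] at hm
    change some (m, v) ∈ y.2.map reflL at hm
    rw [mem_map_reflL_iff] at hm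
    exact hinv.nonneg _ _ hm
  · intro m v hm
    rw [hx'] at hm
    change some (m, v) ∈ y.2.map reflL at hm
    rw [mem_map_reflL_iff] at hm
    have hbd := hinv.bound _ _ hm
    rw [hlev] at hbd
    have := hbd.add_abs_le (C := C) fun m' h' hm' => by
      rw [mem_map_reflL_iff] at hm'
      have := htent _ _ hm'; rw [abs_neg] at this; exact this
    rw [abs_neg] at this
    have := hb; omega

/-! ### The growth dichotomy for the right-to-left block -/

/-- Mountains are symmetric under the reflection of the columns. [folklore] -/
theorem mountain_neg (l : ℤ) (r : WithBot ℤ) (n : ℤ) :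
    GrowthProcess.mountain l r (-n) = GrowthProcess.mountain (-l) r n := by
  unfold GrowthProcess.mountain
  by_cases h : n = -l
  · rw [if_pos (by omega), if_pos h]
  · rw [if_neg (by omega), if_neg h, show -n - l = -(n - -l) by ring, abs_neg]

/-- **The one-step growth dichotomy for a right-to-left block** (GM14 Lemma 6.6 with
`d_{k+1} = d_k - 1`): after the block, the new height of column `c - 1` is below a mountain of
the old heights read in the frame shifted by `d`, or the designated detour event of the
reflected block at the reflected column `-c` holds and the new height is at most the old height
of column `c` plus one. [cite: GrimmettManolescu2014Isoradial, §6.2 Lemma 6.6] -/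
theorem growth_dichotomyRL {W₀ : List SV} {P₀ P₁ : SV} {r : ℕ → B.Noise} {y : ExchangeData.WState}
    (hpar₀ : ∀ m h, some (m, h) ∈ W₀ → Even (m + h))
    (hinv : B.refl.BlockInv (W₀.map reflL) P₀ P₁ r B.N y) (c d : ℤ) :
    (∃ l, colmax (y.2.map reflL) (c - 1) ≤ GrowthProcess.mountain l (colmax W₀ (l + d)) (c - d)) ∨
      (B.refl.Ydet (W₀.map reflL) r (-c) ∧ colmax (y.2.map reflL) (c - 1) ≤ colmax W₀ c + 1) := by
  have hpar' : ∀ m h, some (m, h) ∈ W₀.map reflL → Even (m + h) := by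
    intro m h hm
    rw [mem_map_reflL_iff] at hm
    obtain ⟨a, ha⟩ := hpar₀ _ _ hm; exact ⟨a + m, by omega⟩
  have h := BlockData.growth_dichotomy hpar' hinv (-c) (-d)
  have h1 : colmax y.2 (-c + 1) = colmax (y.2.map reflL) (c - 1) := by
    rw [colmax_map_reflL, show -(c - 1) = -c + 1 by ring]
  rcases h with ⟨l, hl⟩ | ⟨hY, hle⟩
  · left
    refine ⟨-l, ?_⟩
    rw [colmax_map_reflL, show -(l + -d) = -l + d by ring, show -c - -d = -(c - d) by ring, mountain_neg, h1] at hl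
    exact hl
  · right
    rw [colmax_map_reflL, neg_neg, h1] at hle
    exact ⟨hY, hle⟩

end BlockData

end TrackExchange

end Literature.Probability.Percolation
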